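import Summits.BirchSwinnertonDyer.BirchSwinnertonDyer.Theorems.ErratumRoadFiveIMCDivRoadFFFittingCutB
import Summits.BirchSwinnertonDyer.Rank1Residual.X11b.RouteR1ControlCastella
import Summits.BirchSwinnertonDyer.Rank1Residual.X11b.BDPRouteErratumData
import Summits.BirchSwinnertonDyer.Rank1Residual.X11b.BDPRouteSurj
import Summits.BirchSwinnertonDyer.Rank1Residual.Partition.IrreducibleOverQuadraticField
import Literature.NumberTheory.EllipticCurves.SigmaEulerData
import HarnessLib

/-!
# Route `ErratumRoadFive` (rung K2, `p ≥ 5`), crux `IMCDivAtErratumDataAll` → `IMCDivAtErratumDataAllR`: the FIRST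
# Road-FF stub `Σ`-DATA AT EVERY ERRATUM DATUM AND EVERY X-SLOT is a THEOREM modulo ONE published fact (JSW17
# Prop. 3.3.2) — at the typer's concrete choice terms `Σ := ↑(W.sigmaPlacesFinset p K)`, `P_Σ := W.sigmaEulerElement p K κ`

Cell `bsd-stepL` (run/shared/lean/pub/bsd-stepL/), seat `bsd-stepL-imc-p1` (prover g9, 2026-08-27); `--supports
stmt-BirchSwinnertonDyer-19270 --as helper`; Theses-free. Consumes defn-ty1 g2's `Literature/…/SigmaEulerData.lean`
(§5 `JetchevSkinnerWan2017.sigmaData_of_prop332`: the F7 fact `prop332_charIdeal_XAc_sigma_change` ⟹ the BODY of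
`P2.RoadFF.SigmaDataAt W p κ v γ Σ P_Σ` at ANY prime `v ∋ p` read through an embedding inducing it) and discharges its
binders at erratum data: `3 ≤ p` and `Mult W p` from `ErratumHypotheses`; `p` split in the erratum field
(`IsErratumField.splitsIn_of_mult`, `satisfiesHeegnerHypothesis_of_splitsIn`); `E[p]` irreducible over `G_K` from
surjectivity over `ℚ` (`surj_of_irr_of_ram` — the (ram) witness `q` — and `irrK_of_surj`); THE embedding `embAt K p v`
at the degree-one `v` (`mem_asIdeal_iff_norm_embAt_lt_one`); `rank_ℤ E(K) = 1` and `#Ш(E/K)[p^∞] < ∞` by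
Gross–Zagier–Kolyvagin over `ℚ` (`IsErratumField.mordellWeilRank_eq_one_and_shaFinite`, modulo GZK + modularity).

## What this file proves (THEOREMS ONLY; no definition, no named fact, no sorry)

* §1 `P2.RoadFF.sigmaDataAt_of_prop332_of_isErratumField` — at ONE erratum field and ANY prime `v ∋ p`:
  `P2.RoadFF.SigmaDataAt W p κ v γ ↑(W.sigmaPlacesFinset p K) (W.sigmaEulerElement p K κ)`.
* §2 **`P2.RoadFF.sigmaDataAtErratumDataB_of_prop332`** — `P2.RoadFF.SigmaDataAtErratumDataB W p Σ(·) P_Σ(·)` (the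
  first stub of the two-stub v4 on the repaired item, X-slot `𝔭bar`) and, for the record, the A-slot twin
  `P2.RoadFF.sigmaDataAtErratumData_of_prop332` (X-slot `𝔭_{ι'}`) — BOTH from the same three hypotheses
  `prop332_charIdeal_XAc_sigma_change`, `rank_eq_analyticRank_of_analyticRank_le_one`, `exists_isNewformOf`
  (F7 does not see the slot).

So of the two Road-FF stubs only the Fitting-level congruence frame (Hida members + FW21 Thm. 4.41 at `X^Σ` strict at
`𝔭bar` + (c) + descent) remains PREPRINT-shaped. HONEST FRAMING: CONDITIONAL on the three named facts (all PUBLISHED: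
JSW17 Prop. 3.3.2 with Thm. 3.3.1 ∕ proof of Thm. 6.1.6; Gross–Zagier–Kolyvagin; modularity); nothing is booked; BSD is
proved for no pair; no label or census count moves (T7).

References: [JetchevSkinnerWan2017] Prop. 3.3.2, Thm. 3.3.1, proof of Thm. 6.1.6 (arXiv:1512.06894); [Castella2018Erratum]
proof of Thm. 1.1 (p. 4, the set `Σ`); [Castella2018] (3.1); [Skinner2016PacificMC] §2.3 (p. 180, `P_w`).
-/

set_option autoImplicit false

noncomputable section

open scoped Classical

open WeierstrassCurve NumberField IsDedekindDomain Field PowerSeries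
open Literature.NumberTheory.EllipticCurves Literature.NumberTheory.EllipticCurves.GreenbergSelmer
  Literature.NumberTheory.EllipticCurves.ModularForms Literature.NumberTheory.EllipticCurves.Rank1Residual
  Literature.NumberTheory.EllipticCurves.Rank1Residual.Typed Literature.NumberTheory.EllipticCurves.Castella2018
  Literature.NumberTheory.EllipticCurves.JetchevSkinnerWan2017 Literature.NumberTheory.GaloisRepresentations
  Literature.NumberTheory.GaloisCohomology
open Summit.BirchSwinnertonDyer.Rank1Residual.X11b.AcSelmer Summit.BirchSwinnertonDyer.Rank1Residual.X11b.Halves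
open Summit.BirchSwinnertonDyer.Rank1Residual

namespace Summit.BirchSwinnertonDyer.Rank1Residual.X11b

/-! ### §1 At one erratum field and any prime above `p` -/

section OneField

variable (W : WeierstrassCurve ℚ) [W.IsElliptic] [W.IsGloballyMinimal] (p : ℕ) [Fact p.Prime]
  {K : Type} [Field K] [NumberField K]

/-- **`Σ`-data at an erratum field, ANY X-slot `v ∋ p`, from JSW17 Prop. 3.3.2.** For `W/ℚ` globally minimal with
`ErratumHypotheses W p` (`5 ≤ p`, multiplicative `p`, `E[p]` irreducible), a (ram) witness `q ≠ p` (so `ρ̄_{E,p}` is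
onto, `surj_of_irr_of_ram`), `ord_{s=1} L(E,s) = 1`, an erratum field `K` for `q` (`p` splits; `rank_ℤ E(K) = 1`,
`Ш(E/K)` finite by GZK over `ℚ`), an anticyclotomic `κ` with generator `γ` and ANY prime `v ∋ p` of `𝓞 K`:
`P2.RoadFF.SigmaDataAt W p κ v γ ↑(W.sigmaPlacesFinset p K) (W.sigmaEulerElement p K κ)` — defn-ty1's
`sigmaData_of_prop332` read through THE embedding `embAt K p v` (the Summits `XAc` is the Literature one, same term).
CONDITIONAL on `h332`, `hGZK`, `hnf`. [cite: JetchevSkinnerWan2017, Prop. 3.3.2 with Thm. 3.3.1 (arXiv:1512.06894 §3.3)]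
[cite: Castella2018Erratum, proof of Thm. 1.1 (p. 4)] -/
theorem P2.RoadFF.sigmaDataAt_of_prop332_of_isErratumField
    (h332 : prop332_charIdeal_XAc_sigma_change)
    (hGZK : rank_eq_analyticRank_of_analyticRank_le_one) (hnf : exists_isNewformOf)
    (hE : ErratumHypotheses W p) (hr : W.analyticRank = 1) {q : ℕ} [Fact q.Prime] (hqp : q ≠ p)
    (hmq : Mult W q) (hvq : ¬ p ∣ padicValInt q W.minimalDiscriminantInt) (hK : IsErratumField W K q)
    (κ : ZpExtension K p) (hκ : κ.IsAnticyclotomic) (γ : Field.absoluteGaloisGroup K)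
    [Fact (κ.IsTopGenerator γ)] (v : HeightOneSpectrum (𝓞 K)) (hv : ((p : ℕ) : 𝓞 K) ∈ v.asIdeal) :
    P2.RoadFF.SigmaDataAt W p κ v γ (↑(W.sigmaPlacesFinset p K) : Set (HeightOneSpectrum (𝓞 K)))
      (W.sigmaEulerElement p K κ) := by
  have hp3 : 3 ≤ p := le_trans (by norm_num) hE.1
  have hmult : Mult W p := hE.2.1
  have hsurj : Surj W p := surj_of_irr_of_ram W p hE.2.2.1 ⟨q, ‹_›, hqp, hmq, hvq⟩
  have hirrK : (W.baseChange K).HasIrreducibleModPGaloisRep p := irrK_of_surj W p hsurj K hK.1.1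
  have hsp : SplitsIn K p := hK.splitsIn_of_mult hmult (Ne.symm hqp)
  have hHp : SatisfiesHeegnerHypothesis p K := satisfiesHeegnerHypothesis_of_splitsIn Fact.out hsp
  obtain ⟨hrank, hSha⟩ := IsErratumField.mordellWeilRank_eq_one_and_shaFinite W hGZK hnf hr hK
  haveI : Finite (W.baseChange K).sha := hSha
  have hShap : Finite (AddCommGroup.primaryComponent (W.baseChange K).sha p) :=
    Finite.of_injective _ Subtype.val_injective
  obtain ⟨he, hf⟩ := degreeOne_of_splitsIn hK.1.1 hsp hv
  exact sigmaData_of_prop332 h332 W p hp3 (Or.inr hmult) K hK.1 hHp hirrK (embAt K p v hv he hf) v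
    (mem_asIdeal_iff_norm_embAt_lt_one v hv he hf) κ hκ γ hrank hShap

end OneField

/-! ### §2 At every erratum datum: the first Road-FF stub, both slots -/

section OnTree

variable (W : WeierstrassCurve ℚ) [W.IsElliptic] [W.IsGloballyMinimal] (p : ℕ) [Fact p.Prime]

/-- **THE FIRST ROAD-FF STUB ON THE REPAIRED ITEM IS A THEOREM MODULO JSW17 Prop. 3.3.2 (+ GZK, modularity)**:
`P2.RoadFF.SigmaDataAtErratumDataB W p Σ(·) P_Σ(·)` at the typer's concrete choice terms, X-slot `𝔭bar` (§1 at
`v := 𝔭bar`; the datum binders `w₀`, `Dt`, `H`, `P`, `ι'`, `e` are not used — F7 does not see the Heegner datum).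
CONDITIONAL on the three named facts; nothing booked. [cite: JetchevSkinnerWan2017, Prop. 3.3.2 with Thm. 3.3.1 (arXiv:1512.06894 §3.3)]
[cite: Castella2018Erratum, proof of Thm. 1.1 (p. 4)] -/
theorem P2.RoadFF.sigmaDataAtErratumDataB_of_prop332
    (h332 : prop332_charIdeal_XAc_sigma_change)
    (hGZK : rank_eq_analyticRank_of_analyticRank_le_one) (hnf : exists_isNewformOf) :
    P2.RoadFF.SigmaDataAtErratumDataB W p
      (fun K _ _ ↦ (↑(W.sigmaPlacesFinset p K) : Set (HeightOneSpectrum (𝓞 K))))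
      (fun K _ _ κ _ ↦ W.sigmaEulerElement p K κ) := by
  intro _ q _ K _ _ Dt H w₀ P hE hr hqp hmq hns hvq hK hCas hP hc hinf κ hκ γ _ ι' e he 𝔭bar h𝔭bar _
  exact P2.RoadFF.sigmaDataAt_of_prop332_of_isErratumField W p h332 hGZK hnf hE hr hqp hmq hvq hK κ hκ γ
    𝔭bar h𝔭bar

/-- **The A-slot twin** (X-slot = the datum's prime `𝔭_{ι'}`; for crux 19270's own v4, evidence #31): same three
hypotheses. CONDITIONAL; nothing booked. [cite: JetchevSkinnerWan2017, Prop. 3.3.2 with Thm. 3.3.1 (arXiv:1512.06894 §3.3)] -/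
theorem P2.RoadFF.sigmaDataAtErratumData_of_prop332
    (h332 : prop332_charIdeal_XAc_sigma_change)
    (hGZK : rank_eq_analyticRank_of_analyticRank_le_one) (hnf : exists_isNewformOf) :
    P2.RoadFF.SigmaDataAtErratumData W p
      (fun K _ _ ↦ (↑(W.sigmaPlacesFinset p K) : Set (HeightOneSpectrum (𝓞 K))))
      (fun K _ _ κ _ ↦ W.sigmaEulerElement p K κ) := by
  intro _ q _ K _ _ Dt H w₀ P hE hr hqp hmq hns hvq hK hCas hP hc hinf κ hκ γ _ ι' e he
  exact P2.RoadFF.sigmaDataAt_of_prop332_of_isErratumField W p h332 hGZK hnf hE hr hqp hmq hvq hK κ hκ γ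
    _ (natCast_mem_primeOfEmbeddingDatum p ι' w₀.embedding)

end OnTree

end Summit.BirchSwinnertonDyer.Rank1Residual.X11b

end
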